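import Summits.MatrixMultiplication.OmegaCensus.STPPClosureCoreAnyGroup

/-!
# ω-census: filter N12 (symmetric near-period closure) for CKSU Def. 5.1 in ANY finite group (kernel)

HONEST FRAMING (pub-omega census; verbatim): lottery ticket; floor = certified bounds/negative ranges.
Census BOOKKEEPING (seat pub-omega-stpp-1 gen 26, 2026-08-27), family (b2).  A necessary condition on simultaneous-TPP families in
arbitrary finite groups — a tool for EXCLUDING candidate patterns (non-abelian census batches); nothing here is progress on `ω`.

## Statement

The abelian kernel filter N12 (`STPPClosureFilter.lean`, `CubeNB.not_isSTPP_of_n12Dead` for the tree's `IsSTPP`) holds VERBATIM — same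
decidable card-vector predicate `N12Dead n N a b c` — for CKSU Def. 5.1 in an arbitrary finite group `G`
(`Literature.Combinatorics.Additive.SimultaneousTPP`): with `X = ⋃ Aᵢ⁻¹Bᵢ`, `Y = ⋃ Bᵢ⁻¹Cᵢ`, `Z = ⋃ Aᵢ⁻¹Cᵢ` (`QU`), the word
`a a'⁻¹ b b'⁻¹ c c'⁻¹ = 1 ⟺ (a'⁻¹b)(b'⁻¹c) = a⁻¹c'` gives `repMul X Y = |B_j|` on `Z_j` (`repMul_eq_card_B`, so `Σ_{z∈Z} repMul = Σ|Aᵢ||Bᵢ||Cᵢ|`,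
`sum_repMul_QU_AC`), the column/row translate counts `≤ |A_l|`, `≤ |C_l|` (`card_filter_mul_mem_le_card_A/_C`), hence RIGHT near-periods
`|X ∩ Xδ| ≥ σ` on `YY⁻¹` and LEFT near-periods `|Y ∩ gY| ≥ σ'` on `X⁻¹X`; under the N12 hypothesis `D = X⁻¹X = YY⁻¹` is a subgroup by the
pigeonhole closure and the numeric conclusions follow (`false_of_closure_hyp_group`, `STPPClosureCoreAnyGroup.lean`).  The three rotations
are `Literature.Barriers.MatrixMultiplication.simultaneousTPP_rotate`.

* `not_simultaneousTPP_of_n12Dead` — **an STPP family (Def. 5.1 verbatim) with non-empty sets in a finite group `G`, `|G| = n`, whose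
  card vectors satisfy `N12Dead n N a b c`, does not exist**; literal form `not_simultaneousTPP_of_n12Dead'`.
No commutativity, no Kneser.  No census customer yet (the abelian fronts use `STPPClosureFilter.lean`); recorded for non-abelian batches.

References: H. Cohn, R. Kleinberg, B. Szegedy, C. Umans, FOCS 2005 (arXiv:math/0511460), Def. 5.1; J. Blasiak, T. Church, H. Cohn,
J. A. Grochow, E. Naslund, W. F. Sawin, C. Umans, Discrete Analysis 2017:3, §2 (packing injectivity).
-/

open Finset

namespace Summit.MatrixMultiplication.OmegaCensus.CubeNB

variable {G : Type*} [Group G] [DecidableEq G]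

section STPP

open Literature.Combinatorics.Additive

variable {ι : Type*} [Fintype ι] {A B C : ι → Finset G}

/-- **Volume identity (any group).**  `Σ_{z ∈ Z} repMul X Y z = Σᵢ |Aᵢ||Bᵢ||Cᵢ|` for an STPP family with non-empty `Bᵢ`: the map
`(i, a, c) ↦ a⁻¹c` is injective on `⨆ Aᵢ × Cᵢ` (as in `card_QU_AC`) and `repMul = |Bᵢ|` at `a⁻¹c`. [cite: CohnKleinbergSzegedyUmans2005, Def. 5.1] -/
theorem sum_repMul_QU_AC (h : SimultaneousTPP A B C) (hB : ∀ i, (B i).Nonempty) :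
    ∑ z ∈ QU A C, repMul (QU A B) (QU B C) z = ∑ i, #(A i) * #(B i) * #(C i) := by
  classical
  set D : Finset (Σ _ : ι, G × G) := univ.sigma fun i => A i ×ˢ C i with hD
  have hinj : Set.InjOn (fun x : (Σ _ : ι, G × G) => x.2.1⁻¹ * x.2.2) ↑D := by
    rintro ⟨i, a, c⟩ hx ⟨j, a', c'⟩ hy (he : a⁻¹ * c = a'⁻¹ * c')
    simp only [hD, coe_sigma, Set.mem_sigma_iff, coe_univ, Set.mem_univ, true_and, coe_product, Set.mem_prod,
      mem_coe] at hx hy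
    obtain ⟨b, hb⟩ := hB i
    have key : a' * a⁻¹ * b * b⁻¹ * c * c'⁻¹ = 1 := by
      rw [mul_inv_cancel_right, mul_assoc a', he, mul_inv_cancel_left, mul_inv_cancel]
    obtain ⟨rfl, -⟩ := h.2 j i i a' hy.1 a hx.1 b hb b hb c hx.2 c' hy.2 key
    have key' : a' * a⁻¹ * (b * b⁻¹) * (c * c'⁻¹) = 1 := by simpa only [mul_assoc] using key
    obtain ⟨h1, -, h3⟩ := h.1 _ a' hy.1 a hx.1 b hb b hb c hx.2 c' hy.2 key'
    subst h1 h3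
    rfl
  rw [QU, sum_image hinj, hD, sum_sigma]
  refine sum_congr rfl fun i _ => ?_
  have : ∀ p ∈ A i ×ˢ C i, repMul (QU A B) (QU B C) ((⟨i, p⟩ : Σ _ : ι, G × G).2.1⁻¹ * (⟨i, p⟩ : Σ _ : ι, G × G).2.2)
      = #(B i) := by
    intro p hp
    rw [mem_product] at hp
    exact repMul_eq_card_B h hp.1 hp.2
  rw [sum_congr rfl this, sum_const, smul_eq_mul, card_product]
  ring

variable [Fintype G]

/-- **N12, one rotation (any group).**  The card data of an STPP family with non-empty sets satisfy the hypotheses of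
`false_of_closure_hyp_group` as soon as the numeric N12 condition holds. [cite: CohnKleinbergSzegedyUmans2005, Def. 5.1] -/
theorem n12_rotation_group (h : SimultaneousTPP A B C) (hA : ∀ i, (A i).Nonempty) (hB : ∀ i, (B i).Nonempty)
    (hC : ∀ i, (C i).Nonempty) {n : ℕ} (hn : Fintype.card G = n) {a b c : ι → ℕ} (ha : ∀ i, #(A i) = a i)
    (hb : ∀ i, #(B i) = b i) (hc : ∀ i, #(C i) = c i) {ta tc : ℕ} (hta : ∀ i, a i ≤ ta) (htc : ∀ i, c i ≤ tc)
    (hσ1 : 2 * ta + n + 1 ≤ 2 * (∑ i, a i * b i) + ∑ i, a i * c i)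
    (hσ'1 : 2 * tc + n + 1 ≤ 2 * (∑ i, b i * c i) + ∑ i, a i * c i)
    (hbig : (∑ i, a i * b i) + 1 ≤ 2 * (2 * (∑ i, a i * b i) + (∑ i, a i * c i) - (2 * ta + n)) ∨
      (∑ i, b i * c i) + 1 ≤ 2 * (2 * (∑ i, b i * c i) + (∑ i, a i * c i) - (2 * tc + n)))
    (hall : ∀ e : ℕ, e < n + 1 → e ∣ n → 0 < e →
      n12Adm (∑ i, a i * b i) (∑ i, b i * c i) (∑ i, a i * c i) (2 * (∑ i, a i * b i) + (∑ i, a i * c i) - (2 * ta + n))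
        (2 * (∑ i, b i * c i) + (∑ i, a i * c i) - (2 * tc + n)) e = true →
      (∑ i, a i * b i * c i) + (e - ∑ i, a i * c i) * min (∑ i, a i * b i) (∑ i, b i * c i) <
        (∑ i, a i * b i) * (∑ i, b i * c i)) : False := by
  have hX : #(QU A B) = ∑ i, a i * b i := by rw [card_QU_AB h hC]; simp_rw [ha, hb]
  have hY : #(QU B C) = ∑ i, b i * c i := by rw [card_QU_BC h hA]; simp_rw [hb, hc]
  have hZ : #(QU A C) = ∑ i, a i * c i := by rw [card_QU_AC h hB]; simp_rw [ha, hc]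
  have hV : ∑ z ∈ QU A C, repMul (QU A B) (QU B C) z ≤ ∑ i, a i * b i * c i := by
    rw [sum_repMul_QU_AC h hB]; simp_rw [ha, hb, hc]; exact le_rfl
  have hZpos : ∀ z ∈ QU A C, 0 < repMul (QU A B) (QU B C) z := by
    intro z hz
    obtain ⟨j, a', ha', c', hc', rfl⟩ := mem_QU.1 hz
    rw [repMul_eq_card_B h ha' hc']
    exact (hB j).card_pos
  have hcol : ∀ y ∈ QU B C, #((QU A B).filter fun x => x * y ∈ QU A C) ≤ ta := by
    intro y hy
    obtain ⟨l, b', hb', c', hc'', he⟩ := mem_QU.1 hy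
    exact (card_filter_mul_mem_le_card_A h ⟨b', hb', c', hc'', he⟩).trans (by rw [ha]; exact hta l)
  have hrow : ∀ x ∈ QU A B, #((QU B C).filter fun y => x * y ∈ QU A C) ≤ tc := by
    intro x hx
    obtain ⟨l, a', ha', b', hb', he⟩ := mem_QU.1 hx
    exact (card_filter_mul_mem_le_card_C h ⟨a', ha', b', hb', he⟩).trans (by rw [hc]; exact htc l)
  exact false_of_closure_hyp_group hn hX hY hZ hV hZpos hcol hrow hσ1 hσ'1 hbig hall

end STPP

/-! ## The filter theorem in any finite group -/

section Filter

variable [Fintype G] {N : ℕ} {A B C : Fin N → Finset G}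

open Literature.Combinatorics.Additive

/-- **Filter N12, one rotation, any group (kernel).**  An STPP family (Def. 5.1 verbatim) with non-empty sets whose card vectors satisfy
`N12Dead1 |G|` does not exist. [cite: CohnKleinbergSzegedyUmans2005, Def. 5.1] -/
theorem not_simultaneousTPP_of_n12Dead1 (h : SimultaneousTPP A B C) (hA : ∀ i, (A i).Nonempty) (hB : ∀ i, (B i).Nonempty)
    (hC : ∀ i, (C i).Nonempty) {n : ℕ} (hn : Fintype.card G = n) {a b c : Fin N → ℕ} (ha : ∀ i, #(A i) = a i)
    (hb : ∀ i, #(B i) = b i) (hc : ∀ i, #(C i) = c i) (hdead : N12Dead1 n N a b c = true) : False := by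
  simp only [N12Dead1, n12Stmt, Bool.and_eq_true, Bool.or_eq_true, decide_eq_true_eq] at hdead
  obtain ⟨⟨⟨h1, h2⟩, h3⟩, h4⟩ := hdead
  exact n12_rotation_group h hA hB hC hn ha hb hc (fun i => le_sup (f := a) (mem_univ i))
    (fun i => le_sup (f := c) (mem_univ i)) h1 h2 h3 h4

/-- **Filter N12 in ANY finite group (kernel): an STPP family (CKSU Def. 5.1 verbatim, `SimultaneousTPP`) with non-empty sets in a finite
group `G` whose pattern `(|Aᵢ|,|Bᵢ|,|Cᵢ|)ᵢ` is `N12Dead |G|` does not exist** — the three rotations via `simultaneousTPP_rotate`.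
[cite: CohnKleinbergSzegedyUmans2005, Def. 5.1] -/
theorem not_simultaneousTPP_of_n12Dead (h : SimultaneousTPP A B C) (hA : ∀ i, (A i).Nonempty) (hB : ∀ i, (B i).Nonempty)
    (hC : ∀ i, (C i).Nonempty) {n : ℕ} (hn : Fintype.card G = n) {a b c : Fin N → ℕ} (ha : ∀ i, #(A i) = a i)
    (hb : ∀ i, #(B i) = b i) (hc : ∀ i, #(C i) = c i) (hdead : N12Dead n N a b c = true) : False := by
  simp only [N12Dead, Bool.or_eq_true] at hdead
  rcases hdead with (hd | hd) | hd
  · exact not_simultaneousTPP_of_n12Dead1 h hA hB hC hn ha hb hc hd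
  · exact not_simultaneousTPP_of_n12Dead1 (Literature.Barriers.MatrixMultiplication.simultaneousTPP_rotate h)
      hB hC hA hn hb hc ha hd
  · exact not_simultaneousTPP_of_n12Dead1 (Literature.Barriers.MatrixMultiplication.simultaneousTPP_rotate
      (Literature.Barriers.MatrixMultiplication.simultaneousTPP_rotate h)) hC hA hB hn hc ha hb hd

/-- Literal-vector form: non-emptiness from positivity of the entries. [cite: CohnKleinbergSzegedyUmans2005, Def. 5.1] -/
theorem not_simultaneousTPP_of_n12Dead' (h : SimultaneousTPP A B C) {n : ℕ} (hn : Fintype.card G = n) (a b c : Fin N → ℕ)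
    (ha : ∀ i, #(A i) = a i) (hb : ∀ i, #(B i) = b i) (hc : ∀ i, #(C i) = c i)
    (hpos : ∀ i, 0 < a i ∧ 0 < b i ∧ 0 < c i) (hdead : N12Dead n N a b c = true) : False :=
  not_simultaneousTPP_of_n12Dead h (fun i => card_pos.1 ((ha i).symm ▸ (hpos i).1))
    (fun i => card_pos.1 ((hb i).symm ▸ (hpos i).2.1)) (fun i => card_pos.1 ((hc i).symm ▸ (hpos i).2.2))
    hn ha hb hc hdead

end Filter

/-! ## Example: the ℤ₅₇ leaf of `STPPClosureFilter.lean`, now in every group of order 57 -/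

section Examples

variable [Fintype G]

open Literature.Combinatorics.Additive

/-- The pattern `{(1,4,7), (3,2,2), (3,3,2)}` (`∑ abc = 58 > 57`) carries no simultaneous-TPP family (Def. 5.1 verbatim) in ANY finite group
of order `57` (abelian or not — there is a non-abelian one, `ℤ₁₉ ⋊ ℤ₃`): the numeric side `N12Dead 57` is the one evaluated in
`no_isSTPP_Z57_147_322_332`. [cite: CohnKleinbergSzegedyUmans2005, Def. 5.1] -/
theorem no_simultaneousTPP_card57_147_322_332 (hG : Fintype.card G = 57) (A B C : Fin 3 → Finset G)
    (h : SimultaneousTPP A B C) (hA : ∀ i, #(A i) = ![1, 3, 3] i) (hB : ∀ i, #(B i) = ![4, 2, 3] i)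
    (hC : ∀ i, #(C i) = ![7, 2, 2] i) : False :=
  not_simultaneousTPP_of_n12Dead' h hG _ _ _ hA hB hC (by decide) (by decide +kernel)

end Examples

end Summit.MatrixMultiplication.OmegaCensus.CubeNB
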